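import Literature.NumberTheory.QuadraticFields.LenstraPomerancePrescribedCoefficient
import Mathlib.Tactic
import HarnessLib

/-!
# The prime set `𝒫_Δ = {p : (Δ/p) = 1}` of Lenstra–Pomerance 1992, (2.6)–(2.7)

H. W. Lenstra Jr. and C. Pomerance, *A rigorous time bound for factoring integers*,
J. Amer. Math. Soc. **5** (1992) 483–516, §2:

* (2.6) *The Kronecker symbol.* "For any integer `d` that is `0` or `1 mod 4` and any positive
  integer `a`, the Kronecker symbol `(d/a)` is defined as follows. First let `p` be prime. If `p`
  divides `d` then `(d/p) = 0`. If `p` does not divide `d`, then `(d/p)` is `1` if `d` is a square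
  modulo `4p` and `-1` otherwise."
* (2.7) *Prime forms.* "`𝒫_Δ = {p : p is prime, (Δ/p) = 1}`. If `p` is even, then `p ∈ 𝒫_Δ` if and
  only if `p = 2` and `Δ ≡ 1 mod 8`, by (2.6). If `p` is odd, then `p ∈ 𝒫_Δ` if and only if
  `Δ^{(p-1)/2} ≡ 1 mod p`" (Euler's criterion: `p ∤ Δ` and `Δ` is a square mod `p`).

This file defines `kroneckerOnePrimes Δ = 𝒫_Δ` literally by (2.6) (`p` prime, `p ∤ Δ`, `Δ` a square
modulo `4p`) and proves the two descriptions of (2.7) (`two_mem_kroneckerOnePrimes_iff`,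
`mem_kroneckerOnePrimes_iff_of_ne_two`), together with **Lemma 2.10 in its printed form**
(`exists_mem_reducedForms_of_primeFactors_subset`: a reduced form `(a, b, c) ∈ C_Δ` exists for
every `1 ≤ a ≤ ½√|Δ|` all of whose prime factors lie in `𝒫_Δ`; from
`exists_mem_reducedForms_fst_eq` of `LenstraPomerancePrescribedCoefficient`).
Mathlib has `jacobiSym`/`legendreSym` but no Kronecker symbol at `p = 2` (its `legendreSym 2` is
the trivial character mod `2`), hence the direct definition. No named facts.
-/

namespace Literature.NumberTheory.QuadraticFields.BinaryQuadraticForm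

/-- **`𝒫_Δ`**, the set of primes `p` with Kronecker symbol `(Δ/p) = 1`: `p` prime, `p ∤ Δ`, and `Δ`
is a square modulo `4p` [LP92 (2.6)–(2.7)]. For a negative discriminant `Δ` these are the primes
`p` for which the prime form `f_p = (p, b_p, (b_p² - Δ)/(4p))` exists.
[cite: LenstraPomerance1992, §2 (2.6)–(2.7) (p. 488)] -/
def kroneckerOnePrimes (Δ : ℤ) : Set ℕ :=
  {p | p.Prime ∧ ¬ (p : ℤ) ∣ Δ ∧ ∃ b : ℤ, (4 * p : ℤ) ∣ b ^ 2 - Δ}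

/-- Unfolding `kroneckerOnePrimes`. [cite: LenstraPomerance1992, §2 (2.6)–(2.7) (p. 488)] -/
theorem mem_kroneckerOnePrimes {Δ : ℤ} {p : ℕ} :
    p ∈ kroneckerOnePrimes Δ ↔ p.Prime ∧ ¬ (p : ℤ) ∣ Δ ∧ ∃ b : ℤ, (4 * p : ℤ) ∣ b ^ 2 - Δ :=
  Iff.rfl

/-- Members of `𝒫_Δ` are primes. [cite: LenstraPomerance1992, §2 (2.7) (p. 488)] -/
theorem prime_of_mem_kroneckerOnePrimes {Δ : ℤ} {p : ℕ} (h : p ∈ kroneckerOnePrimes Δ) :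
    p.Prime :=
  h.1

/-- Members of `𝒫_Δ` do not divide `Δ`. [cite: LenstraPomerance1992, §2 (2.6) (p. 488)] -/
theorem not_dvd_of_mem_kroneckerOnePrimes {Δ : ℤ} {p : ℕ} (h : p ∈ kroneckerOnePrimes Δ) :
    ¬ (p : ℤ) ∣ Δ :=
  h.2.1

/-- **(2.7), even prime**: `2 ∈ 𝒫_Δ` iff `Δ ≡ 1 (mod 8)`.
[cite: LenstraPomerance1992, §2 (2.7) (p. 488)] -/
theorem two_mem_kroneckerOnePrimes_iff {Δ : ℤ} : 2 ∈ kroneckerOnePrimes Δ ↔ Δ % 8 = 1 := by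
  rw [mem_kroneckerOnePrimes]
  push_cast
  constructor
  · rintro ⟨-, h2, b, k, hk⟩
    have hb : ¬ (2 : ℤ) ∣ b := by
      rintro ⟨j, rfl⟩
      exact h2 ⟨2 * j ^ 2 - 4 * k, by linear_combination -hk⟩
    obtain ⟨j, rfl⟩ : ∃ j, b = 2 * j + 1 := ⟨b / 2, by omega⟩
    -- `(2j+1)² = 4j(j+1) + 1 ≡ 1 (mod 8)`
    have h8 : (8 : ℤ) ∣ (2 * j + 1) ^ 2 - 1 := by
      rcases Int.even_or_odd j with ⟨i, rfl⟩ | ⟨i, rfl⟩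
      · exact ⟨2 * i ^ 2 + i, by ring⟩
      · exact ⟨2 * i ^ 2 + 3 * i + 1, by ring⟩
    obtain ⟨m, hm⟩ := h8
    omega
  · intro h
    refine ⟨Nat.prime_two, fun ⟨k, hk⟩ => by omega, 1, -(Δ / 8), by omega⟩

/-- **(2.7), odd primes**: for `Δ ≡ 0, 1 (mod 4)` and an odd prime `p`, `p ∈ 𝒫_Δ` iff `p ∤ Δ` and
`Δ` is a square modulo `p` (Euler: `Δ^{(p-1)/2} ≡ 1 mod p`).
[cite: LenstraPomerance1992, §2 (2.7) (p. 488)] -/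
theorem mem_kroneckerOnePrimes_iff_of_ne_two {Δ : ℤ} (h4 : Δ % 4 = 0 ∨ Δ % 4 = 1) {p : ℕ}
    (hp : p.Prime) (hp2 : p ≠ 2) :
    p ∈ kroneckerOnePrimes Δ ↔ ¬ (p : ℤ) ∣ Δ ∧ ∃ x : ℤ, (p : ℤ) ∣ x ^ 2 - Δ := by
  rw [mem_kroneckerOnePrimes]
  constructor
  · rintro ⟨-, hpΔ, b, hb⟩
    exact ⟨hpΔ, b, dvd_trans ⟨4, by ring⟩ hb⟩
  · rintro ⟨hpΔ, hx⟩
    refine ⟨hp, hpΔ, ?_⟩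
    have h4sq : ∃ x : ℤ, ((4 : ℕ) : ℤ) ∣ x ^ 2 - Δ := by
      rcases h4 with h | h
      · exact ⟨0, by push_cast; omega⟩
      · exact ⟨1, by push_cast; omega⟩
    have hcop : Nat.Coprime 4 p :=
      Nat.Coprime.pow_left 2 ((Nat.coprime_primes Nat.prime_two hp).2 (Ne.symm hp2))
    obtain ⟨z, hz⟩ := exists_sq_sub_dvd_mul_of_coprime hcop h4sq hx
    exact ⟨z, by exact_mod_cast hz⟩

/-- The prime factors of an `a` with `primeFactors a ⊆ 𝒫_Δ` satisfy the hypotheses `h2`, `hodd` of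
`exists_mem_reducedForms_fst_eq`. [cite: LenstraPomerance1992, §2 (2.7) (p. 488)] -/
theorem kroneckerOnePrimes_conditions {Δ : ℤ} (h4 : Δ % 4 = 0 ∨ Δ % 4 = 1) {a : ℕ}
    (ha : a ≠ 0) (hP : ∀ p ∈ a.primeFactors, p ∈ kroneckerOnePrimes Δ) :
    (2 ∣ a → Δ % 8 = 1) ∧
      (∀ p ∈ a.primeFactors, p ≠ 2 → ¬ (p : ℤ) ∣ Δ ∧ ∃ x : ℤ, (p : ℤ) ∣ x ^ 2 - Δ) := by
  refine ⟨fun h2a => ?_, fun p hp hp2 => ?_⟩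
  · exact two_mem_kroneckerOnePrimes_iff.1
      (hP 2 (Nat.mem_primeFactors.2 ⟨Nat.prime_two, h2a, ha⟩))
  · exact (mem_kroneckerOnePrimes_iff_of_ne_two h4 (Nat.prime_of_mem_primeFactors hp) hp2).1
      (hP p hp)

/-- **Lenstra–Pomerance 1992, Lemma 2.10 (printed form).** Let `Δ` be a negative discriminant and
`a` an integer with `1 ≤ a ≤ ½√|Δ|` (`4a² ≤ |Δ|`) all of whose prime factors belong to `𝒫_Δ`.
Then there exist `b, c ∈ ℤ` with `(a, b, c) ∈ C_Δ` (a reduced primitive positive definite form of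
discriminant `Δ`). [cite: LenstraPomerance1992, §2 Lemma 2.10 (p. 489)] -/
theorem exists_mem_reducedForms_of_primeFactors_subset {Δ : ℤ} (hΔ : Δ < 0)
    (h4 : Δ % 4 = 0 ∨ Δ % 4 = 1) {a : ℕ} (ha : 0 < a) (hale : 4 * a ^ 2 ≤ Δ.natAbs)
    (hP : ∀ p ∈ a.primeFactors, p ∈ kroneckerOnePrimes Δ) :
    ∃ b c : ℤ, ((a : ℤ), b, c) ∈ reducedForms Δ := by
  obtain ⟨h2, hodd⟩ := kroneckerOnePrimes_conditions h4 ha.ne' hP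
  exact exists_mem_reducedForms_fst_eq hΔ h4 ha hale h2 hodd

/-- An `a` all of whose prime factors lie in `𝒫_Δ` is coprime to `Δ`. [cite: LenstraPomerance1992, §2 (2.8)–(2.9) (p. 489)] -/
theorem coprime_of_primeFactors_subset_kroneckerOnePrimes {Δ : ℤ} {a : ℕ}
    (hP : ∀ p ∈ a.primeFactors, p ∈ kroneckerOnePrimes Δ) (ha : a ≠ 0) :
    Nat.Coprime a Δ.natAbs := by
  refine Nat.coprime_of_dvd fun q hq hqa hqΔ => ?_
  have hmem : q ∈ a.primeFactors := Nat.mem_primeFactors.2 ⟨hq, hqa, ha⟩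
  exact not_dvd_of_mem_kroneckerOnePrimes (hP q hmem) (Int.natCast_dvd.2 hqΔ)

end Literature.NumberTheory.QuadraticFields.BinaryQuadraticForm
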